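import Literature.NumberTheory.CubicFields.DualWeightOrbitSum
import Literature.NumberTheory.CubicFields.NonFundCountShintaniCoeff
import Literature.NumberTheory.CubicFields.ThreeTorsionMeanTwoAdicSieveAssembly
import Mathlib.NumberTheory.Harmonic.Bounds
import HarnessLib

/-!
# BTT Proposition 5.1 from its inputs: `Σ_{q ∈ [Q,2Q]} δ̂₁(q) ≪_ε Q^{2+ε}`

Topic `Literature/NumberTheory/CubicFields`; continues `DualWeightOrbitSum.lean` (the dual-coefficient sums of an
invariant weight as weighted counts of typed orbits, both ranges per type) for the sieve weights `Φ_q = Ψ_{q²}`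
(`psiMod q`, `NonFundCountShintaniCoeff.lean`). Everything here is PROVED.

Bhargava–Taniguchi–Thorne 2023, Proposition 5.1: "We have `Σ_{q ∈ [Q, 2Q]} δ̂₁(q) ≪_ε Q^{2+ε}`", where (Thm 3.1 (18))
`δ̂₁(q) = δ̂₁(Ψ_{q²}) = (16q²)⁴ sup_N N⁻¹ Σ_α Σ_{n<N} a^α(|Ψ̂_{q²}|, n)` (`dualDensity (psiMod q)`; the tree's `Ψ_{q²}` lives
on `V(ℤ/16q²ℤ)`). The printed proof (p. 16): Prop. 5.2 bounds `|Ψ̂_{p²}|` on `V(ℤ/p²ℤ)` in five cases; multiplying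
over `p ∣ q` and counting orbits by type `q = c₂c₁d₄d₃…` via Lemma 2.3, (39): the contribution of a type is
`≪ N q^{8+ε}/(c₂^{10} c₁⁷ d_{4c}⁸ d_{4n}⁷ D₃⁶ d₂⁷) · max(1, …)`; for `N ≤ Q^{100}` sum `d₃` over dyadic blocks first
("for each fixed `x'` … at most `O(Q^ε)` such `d₃` with `d₃ ∣ Disc(x')`", then Prop. 4.5), (42):
`≪ N Q^{-6+ε} max(1, N^{-1/6}Q)`; for `N > Q^{100}` Prop. 4.7 "more than suffices". This file assembles:

* `sum_q_typeSum_le` — exchanging `Σ_q` and `Σ_τ` (a type belongs to at most `6` squarefree `q`);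
* `innerSum_le`, `sum_adm_weight_cnt_le` — the small range summed over admissible types
  (`≪ (log terms) · N^δ · N/Q⁶`);
* `inv_mul_dualSum_le`, `dualDensity_psiMod_le` — the supremum over `N` per `q`: dyadic `N ≤ 2^{J₀}` by
  monotonicity, `N ≥ 2^{J₀} ≥ K_B (2Q)^{35}` by the large range (`largeConst`, `sum_largeConst_le`);
* `sum_dualDensity_le_master` and **`dualDensityPsiBound_of_divCountBound`** — for every `ε > 0` there is `C` with
  `DualDensityPsiBound ε C`, GIVEN Prop. 4.5 (`btt_uniformity_sqDvd`), a terminal count `DivCountBound C_B K_B`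
  (from Thm 3.2 + Thm 2.4, `ShintaniDivResidues.lean`) and the prime-by-prime Fourier majorants of the `Φ_q`
  (Prop. 5.2, `PsiFourierMajorant.lean`).

The tree's level is `16q²` rather than `q²` and the weights are the second `Ψ` of §5; constants differ from the
paper's, exponents do not.

## References

* M. Bhargava, T. Taniguchi, F. Thorne, *Improved error estimates for the Davenport–Heilbronn theorems*,
  Math. Ann. 389 (2024) = arXiv:2107.12819, Prop. 5.1 and its proof, (39)–(42) [BhargavaTaniguchiThorne2023].
* G. H. Hardy, E. M. Wright, *An Introduction to the Theory of Numbers*, Thm 315 (the divisor bound) [HardyWright2008].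
-/

noncomputable section

namespace Literature.NumberTheory.CubicFields

open BinaryCubic Finset Classical

/-! ### The small regime: exchanging `Σ_q` and `Σ_τ`, dyadic blocks in `d₃` -/

section FinalTwo

/-- **Admissible types at scale `Q`**: `τ` is the type of some squarefree `q ∈ [Q, 2Q]`, i.e. `∏τ = u(q)`. [folklore] -/
def Adm (Q : ℕ) (τ : ℕ × ℕ × ℕ × ℕ) : Prop :=
  ∃ q ∈ (Finset.Icc Q (2 * Q)).filter Squarefree, roughPart q = τ.1 * τ.2.1 * τ.2.2.1 * τ.2.2.2

/-- The product of an admissible type is squarefree. [folklore] -/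
theorem Adm.squarefree {Q : ℕ} {τ : ℕ × ℕ × ℕ × ℕ} (h : Adm Q τ) :
    Squarefree (τ.1 * τ.2.1 * τ.2.2.1 * τ.2.2.2) := by
  obtain ⟨q, -, hq⟩ := h
  rw [← hq]
  exact squarefree_roughPart q

/-- An admissible type has product `≥ Q/6`. [folklore] -/
theorem Adm.cast_Q_le {Q : ℕ} {τ : ℕ × ℕ × ℕ × ℕ} (h : Adm Q τ) :
    (Q : ℝ) ≤ 6 * ((τ.1 * τ.2.1 * τ.2.2.1 * τ.2.2.2 : ℕ) : ℝ) := by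
  obtain ⟨q, hq, hqu⟩ := h
  obtain ⟨hqI, hsq⟩ := Finset.mem_filter.mp hq
  have h1 : Q ≤ q := (Finset.mem_Icc.mp hqI).1
  have h2 := le_six_mul_roughPart hsq
  rw [hqu] at h2
  exact_mod_cast h1.trans h2

/-- An admissible type has product `≤ 2Q`. [folklore] -/
theorem Adm.prod_le {Q : ℕ} {τ : ℕ × ℕ × ℕ × ℕ} (h : Adm Q τ) : τ.1 * τ.2.1 * τ.2.2.1 * τ.2.2.2 ≤ 2 * Q := by
  obtain ⟨q, hq, hqu⟩ := h
  obtain ⟨hqI, hsq⟩ := Finset.mem_filter.mp hq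
  rw [← hqu]
  exact (Nat.le_of_dvd (Nat.pos_of_ne_zero hsq.ne_zero) (roughPart_dvd hsq)).trans (Finset.mem_Icc.mp hqI).2

/-- At most `6` squarefree `q` share the value `u(q) = v` (`q/v ∈ {1, 2, 3, 6}`). [folklore] -/
theorem card_filter_roughPart_eq_le (S : Finset ℕ) (hS : ∀ q ∈ S, Squarefree q) (v : ℕ) :
    (S.filter (fun q => roughPart q = v)).card ≤ 6 := by
  have h := Finset.card_le_card_of_injOn (s := S.filter (fun q => roughPart q = v)) (t := Finset.Icc 1 6)
    (fun q => q / v) ?_ ?_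
  · simpa using h
  · intro q hq
    obtain ⟨hqS, hqv⟩ := Finset.mem_filter.mp (Finset.mem_coe.mp hq)
    have hsq := hS q hqS
    have hdvd : v ∣ q := hqv ▸ roughPart_dvd hsq
    have hv0 : 0 < v := hqv ▸ roughPart_pos q
    rw [Finset.mem_coe, Finset.mem_Icc]
    refine ⟨Nat.div_pos (Nat.le_of_dvd (Nat.pos_of_ne_zero hsq.ne_zero) hdvd) hv0, ?_⟩
    refine Nat.div_le_of_le_mul ?_
    have := le_six_mul_roughPart hsq
    rw [hqv] at this
    linarith
  · intro q hq q' hq' h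
    obtain ⟨hqS, hqv⟩ := Finset.mem_filter.mp (Finset.mem_coe.mp hq)
    obtain ⟨hqS', hqv'⟩ := Finset.mem_filter.mp (Finset.mem_coe.mp hq')
    have hdvd : v ∣ q := hqv ▸ roughPart_dvd (hS q hqS)
    have hdvd' : v ∣ q' := hqv' ▸ roughPart_dvd (hS q' hqS')
    simp only at h
    rw [← Nat.div_mul_cancel hdvd, ← Nat.div_mul_cancel hdvd', h]

/-- **Exchanging `Σ_q` and `Σ_τ`**: for nonnegative `F`,
`Σ_{q ∈ [Q,2Q] sqfree} Σ_{τ: ∏τ = u(q)} F(τ) ≤ 6 Σ_{τ admissible} F(τ)`.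
[cite: BhargavaTaniguchiThorne2023, §5 (eq. bound_delta_2b: "The outer sum is over all 7-tuples …")] -/
theorem sum_q_typeSum_le (Q B : ℕ) (F : ℕ × ℕ × ℕ × ℕ → ℝ) (hF : ∀ τ, 0 ≤ F τ) :
    ∑ q ∈ (Finset.Icc Q (2 * Q)).filter Squarefree,
        ∑ τ ∈ tupleBox B, (if τ.1 * τ.2.1 * τ.2.2.1 * τ.2.2.2 = roughPart q then F τ else 0)
      ≤ 6 * ∑ τ ∈ tupleBox B, (if Adm Q τ then F τ else 0) := by
  rw [Finset.sum_comm, Finset.mul_sum]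
  refine Finset.sum_le_sum fun τ _ => ?_
  have hS : ∀ q ∈ (Finset.Icc Q (2 * Q)).filter Squarefree, Squarefree q := fun q hq => (Finset.mem_filter.mp hq).2
  rw [← Finset.sum_filter, Finset.sum_const, nsmul_eq_mul]
  by_cases hadm : Adm Q τ
  · rw [if_pos hadm]
    have hcard : ((((Finset.Icc Q (2 * Q)).filter Squarefree).filter
        (fun q => τ.1 * τ.2.1 * τ.2.2.1 * τ.2.2.2 = roughPart q)).card : ℝ) ≤ 6 := by
      have h := card_filter_roughPart_eq_le _ hS (τ.1 * τ.2.1 * τ.2.2.1 * τ.2.2.2)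
      have he : ((Finset.Icc Q (2 * Q)).filter Squarefree).filter (fun q => τ.1 * τ.2.1 * τ.2.2.1 * τ.2.2.2 = roughPart q)
          = ((Finset.Icc Q (2 * Q)).filter Squarefree).filter (fun q => roughPart q = τ.1 * τ.2.1 * τ.2.2.1 * τ.2.2.2) :=
        Finset.filter_congr fun q _ => eq_comm
      rw [he]
      exact_mod_cast h
    exact mul_le_mul_of_nonneg_right hcard (hF τ)
  · have he : ((Finset.Icc Q (2 * Q)).filter Squarefree).filter
        (fun q => τ.1 * τ.2.1 * τ.2.2.1 * τ.2.2.2 = roughPart q) = ∅ :=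
      Finset.filter_eq_empty_iff.mpr fun q hq h => hadm ⟨q, hq, h.symm⟩
    rw [he, Finset.card_empty, Nat.cast_zero, zero_mul, if_neg hadm, mul_zero]

/-- **Small regime, one type and sign**: peel `d₃` and lower the height to the dyadic value `Y₀/4^{⌊log₂ d₃⌋} ≥ Y₀/d₃²`.
[cite: BhargavaTaniguchiThorne2023, §5 (N ≤ Q^{100}: "we consider the bound (39) with … D₃ … any dyadic range")] -/
theorem cnt_small_le {α : ℤ} {c₂ c₁ d₄ d₃ : ℕ} (hsq : Squarefree (c₂ * c₁ * d₄ * d₃)) (Y₀ : ℝ) :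
    ((divFam α Y₀ 1 1 d₄.primeFactors d₃.primeFactors).ncard : ℝ) ≤
      3 ^ d₃.primeFactors.card *
        ((divFam α (Y₀ / (4 : ℝ) ^ Nat.log 2 d₃) 1 d₃ d₄.primeFactors ∅).ncard : ℝ) := by
  obtain ⟨h43', h123, hsq3⟩ := Nat.squarefree_mul_iff.mp hsq
  obtain ⟨-, -, hsq4⟩ := Nat.squarefree_mul_iff.mp h123
  have h43 : d₄.Coprime d₃ := Nat.Coprime.coprime_mul_left h43'
  have hd3 : ∏ p ∈ d₃.primeFactors, p = d₃ := Nat.prod_primeFactors_of_squarefree hsq3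
  have hpf4 : ∀ ℓ ∈ d₄.primeFactors, ℓ.Prime := fun ℓ hℓ => Nat.prime_of_mem_primeFactors hℓ
  have hpf3 : ∀ ℓ ∈ d₃.primeFactors, ℓ.Prime := fun ℓ hℓ => Nat.prime_of_mem_primeFactors hℓ
  have h1 := ncard_divFam_P3_all (s := α) (m := 1) (P4 := d₄.primeFactors) hpf4 d₃.primeFactors Y₀ 1 hpf3
    (Nat.Coprime.disjoint_primeFactors h43) (Nat.coprime_one_left _) (Nat.coprime_one_left _)
  rw [hd3, one_mul] at h1
  have hd30 : d₃ ≠ 0 := hsq3.ne_zero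
  -- `Y₀/d₃² ≤ Y₀/4^{log₂ d₃}` when `Y₀ ≥ 0`; when `Y₀ < 0` both families are empty
  have hmono : ((divFam α (Y₀ / (d₃ : ℝ) ^ 2) 1 d₃ d₄.primeFactors ∅).ncard : ℝ) ≤
      ((divFam α (Y₀ / (4 : ℝ) ^ Nat.log 2 d₃) 1 d₃ d₄.primeFactors ∅).ncard : ℝ) := by
    by_cases hY : 0 ≤ Y₀
    · have hle : Y₀ / (d₃ : ℝ) ^ 2 ≤ Y₀ / (4 : ℝ) ^ Nat.log 2 d₃ := by
        refine div_le_div_of_nonneg_left hY (by positivity) ?_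
        have h := Nat.pow_log_le_self 2 hd30
        have h4 : (4 : ℕ) ^ Nat.log 2 d₃ ≤ d₃ ^ 2 :=
          calc (4 : ℕ) ^ Nat.log 2 d₃ = (2 ^ 2) ^ Nat.log 2 d₃ := by norm_num
            _ = (2 ^ Nat.log 2 d₃) ^ 2 := by rw [← pow_mul, ← pow_mul, mul_comm]
            _ ≤ d₃ ^ 2 := Nat.pow_le_pow_left h 2
        exact_mod_cast h4
      exact_mod_cast Set.ncard_le_ncard (divFam_mono (s := α) (m := 1) (t := d₃) (P4 := d₄.primeFactors) (P3 := ∅) hle)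
        (divFam_finite _ _ _ _ _ _)
    · push Not at hY
      have hlt : Y₀ / (d₃ : ℝ) ^ 2 < 1 := by
        have : Y₀ / (d₃ : ℝ) ^ 2 ≤ 0 := div_nonpos_of_nonpos_of_nonneg hY.le (by positivity)
        linarith
      rw [divFam_eq_empty_of_lt_one hlt, Set.ncard_empty, Nat.cast_zero]
      positivity
  calc ((divFam α Y₀ 1 1 d₄.primeFactors d₃.primeFactors).ncard : ℝ)
      ≤ 3 ^ d₃.primeFactors.card * ((divFam α (Y₀ / (d₃ : ℝ) ^ 2) 1 d₃ d₄.primeFactors ∅).ncard : ℝ) := by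
        exact_mod_cast h1
    _ ≤ _ := mul_le_mul_of_nonneg_left hmono (by positivity)

/-- **Small regime, the `d₃`-sum for fixed `(c₂, c₁, d₄)` and sign**, by dyadic blocks `2^j ≤ d₃ < 2^{j+1}`:
each block costs `(2^j)⁻⁴ · C₃ · blockSum ≤ C₃ A 20^{ω(d₄)} Y₀/d₄⁴ · 2^{-6j}`, and an admissible block has
`2^{-6j} ≤ (12 c₂c₁d₄/Q)⁶` (`Q ≤ 6u < 12 c₂c₁d₄ 2^j`).
[cite: BhargavaTaniguchiThorne2023, §5 (N ≤ Q^{100}: (42) and "since N < Q^{100} we have N^ε ≪ Q^ε")] -/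
theorem innerSum_le {Cδ δ C_U : ℝ} (hδ : 0 < δ) (hCδ : ∀ n : ℕ, ((n.divisors.card : ℕ) : ℝ) ≤ Cδ * (n : ℝ) ^ δ)
    (hC : ∀ q : ℕ, Squarefree q → ∀ s : ℤ, (s = 1 ∨ s = -1) → ∀ X : ℕ,
      (((∑ D ∈ (discWindow s X).filter (fun D => (q : ℤ) ^ 2 ∣ D), classNumber D : ℕ) : ℝ))
        ≤ C_U * 6 ^ q.primeFactors.card * X / (q : ℝ) ^ 2)
    {B : ℕ} {C₃B : ℝ} (hC₃0 : 0 ≤ C₃B) (h3 : ∀ d ∈ Finset.Icc 1 B, (3 : ℝ) ^ d.primeFactors.card ≤ C₃B)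
    {α : ℤ} (hα : α = 1 ∨ α = -1) {Q : ℕ} (hQ : 1 ≤ Q) {N : ℝ} (hN : 0 ≤ N) {c₂ c₁ d₄ : ℕ} (hc₂ : 1 ≤ c₂) (hc₁ : 1 ≤ c₁)
    (hd₄ : 1 ≤ d₄) :
    ∑ d₃ ∈ Finset.Icc 1 B, (if Adm Q (c₂, c₁, d₄, d₃) then
        ((d₃ : ℝ) ^ 4)⁻¹ * (3 ^ d₃.primeFactors.card *
          ((divFam α (N / ((c₂ ^ 2 * c₁ : ℕ) : ℝ) ^ 4 / (4 : ℝ) ^ Nat.log 2 d₃) 1 d₃ d₄.primeFactors ∅).ncard : ℝ)) else 0)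
      ≤ ((Nat.log 2 B + 1 : ℕ) : ℝ) * (C₃B * (2 * Cδ * N ^ δ * C_U) * 20 ^ d₄.primeFactors.card *
          (N / ((c₂ ^ 2 * c₁ : ℕ) : ℝ) ^ 4 / (d₄ : ℝ) ^ 4) * (12 * ((c₂ * c₁ * d₄ : ℕ) : ℝ) / Q) ^ 6) := by
  have hCδ0 : 0 ≤ Cδ := by
    have h := hCδ 1; simp at h; linarith
  have hCU0 : 0 ≤ C_U := nonneg_of_uniformity_const hC
  set Y₀ : ℝ := N / ((c₂ ^ 2 * c₁ : ℕ) : ℝ) ^ 4 with hY₀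
  set A : ℝ := 2 * Cδ * N ^ δ * C_U with hA
  set E : ℝ := C₃B * A * 20 ^ d₄.primeFactors.card * (Y₀ / (d₄ : ℝ) ^ 4) * (12 * ((c₂ * c₁ * d₄ : ℕ) : ℝ) / Q) ^ 6
    with hE
  have hNδ : 0 ≤ N ^ δ := Real.rpow_nonneg hN δ
  have hY₀0 : 0 ≤ Y₀ := by rw [hY₀]; positivity
  have hcc : (1 : ℝ) ≤ ((c₂ ^ 2 * c₁ : ℕ) : ℝ) := by
    have : 1 ≤ c₂ ^ 2 * c₁ := Nat.one_le_iff_ne_zero.mpr (mul_ne_zero (pow_ne_zero 2 (by omega)) (by omega))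
    exact_mod_cast this
  have hY₀N : Y₀ ≤ N := by rw [hY₀]; exact div_le_self hN (one_le_pow₀ hcc)
  have hA0 : 0 ≤ A := by rw [hA]; exact mul_nonneg (mul_nonneg (mul_nonneg (by norm_num) hCδ0) hNδ) hCU0
  have hQ0 : (0 : ℝ) < Q := by exact_mod_cast hQ
  have hE0 : 0 ≤ E := by rw [hE]; positivity
  have hd40 : (0 : ℝ) < d₄ := by exact_mod_cast hd₄
  -- fiberwise over `j = ⌊log₂ d₃⌋`
  have hmaps : ∀ d ∈ Finset.Icc 1 B, Nat.log 2 d ∈ Finset.range (Nat.log 2 B + 1) := fun d hd =>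
    Finset.mem_range.mpr (Nat.lt_succ_of_le (Nat.log_mono_right (Finset.mem_Icc.mp hd).2))
  rw [← Finset.sum_fiberwise_of_maps_to hmaps]
  have hfib : ∀ j ∈ Finset.range (Nat.log 2 B + 1),
      ∑ d₃ ∈ (Finset.Icc 1 B).filter (fun d => Nat.log 2 d = j), (if Adm Q (c₂, c₁, d₄, d₃) then
        ((d₃ : ℝ) ^ 4)⁻¹ * (3 ^ d₃.primeFactors.card *
          ((divFam α (Y₀ / (4 : ℝ) ^ Nat.log 2 d₃) 1 d₃ d₄.primeFactors ∅).ncard : ℝ)) else 0) ≤ E := by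
    intro j _
    by_cases hex : ∃ d₀ ∈ (Finset.Icc 1 B).filter (fun d => Nat.log 2 d = j), Adm Q (c₂, c₁, d₄, d₀)
    · obtain ⟨d₀, hd₀, hadm₀⟩ := hex
      obtain ⟨-, hd₀j⟩ := Finset.mem_filter.mp hd₀
      have hsq₀ : Squarefree (c₂ * c₁ * d₄ * d₀) := hadm₀.squarefree
      obtain ⟨-, h124, -⟩ := Nat.squarefree_mul_iff.mp hsq₀
      obtain ⟨-, -, hsq4⟩ := Nat.squarefree_mul_iff.mp h124
      have hQle : (Q : ℝ) ≤ 6 * ((c₂ * c₁ * d₄ * d₀ : ℕ) : ℝ) := hadm₀.cast_Q_le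
      have hd₀lt : d₀ < 2 ^ (j + 1) := hd₀j ▸ Nat.lt_pow_succ_log_self one_lt_two d₀
      -- the constraint of an admissible block
      have hj6 : ((((2 : ℝ) ^ j) ^ 6))⁻¹ ≤ (12 * ((c₂ * c₁ * d₄ : ℕ) : ℝ) / Q) ^ 6 := by
        rw [← inv_pow]
        refine pow_le_pow_left₀ (by positivity) ?_ 6
        rw [le_div_iff₀ hQ0, inv_mul_le_iff₀ (by positivity)]
        have hd₀r : (d₀ : ℝ) ≤ 2 ^ (j + 1) := by exact_mod_cast hd₀lt.le
        calc (Q : ℝ) ≤ 6 * ((c₂ * c₁ * d₄ * d₀ : ℕ) : ℝ) := hQle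
          _ = 6 * ((c₂ * c₁ * d₄ : ℕ) : ℝ) * d₀ := by push_cast; ring
          _ ≤ 6 * ((c₂ * c₁ * d₄ : ℕ) : ℝ) * 2 ^ (j + 1) := mul_le_mul_of_nonneg_left hd₀r (by positivity)
          _ = 2 ^ j * (12 * ((c₂ * c₁ * d₄ : ℕ) : ℝ)) := by ring
      set D : Finset ℕ := ((Finset.Icc 1 B).filter (fun d => Nat.log 2 d = j)).filter (fun d => d.Coprime d₄) with hD
      have hterm : ∀ d ∈ (Finset.Icc 1 B).filter (fun d => Nat.log 2 d = j),
          (if Adm Q (c₂, c₁, d₄, d) then ((d : ℝ) ^ 4)⁻¹ * (3 ^ d.primeFactors.card *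
            ((divFam α (Y₀ / (4 : ℝ) ^ Nat.log 2 d) 1 d d₄.primeFactors ∅).ncard : ℝ)) else 0) ≤
          (((2 : ℝ) ^ j) ^ 4)⁻¹ * C₃B *
            (if d.Coprime d₄ then ((divFam α (Y₀ / (4 : ℝ) ^ j) 1 d d₄.primeFactors ∅).ncard : ℝ) else 0) := by
        intro d hd
        obtain ⟨hdI, hdj⟩ := Finset.mem_filter.mp hd
        have hd1 : 1 ≤ d := (Finset.mem_Icc.mp hdI).1
        by_cases hadm : Adm Q (c₂, c₁, d₄, d)
        · have hcop : d.Coprime d₄ := by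
            have hsq' : Squarefree (c₂ * c₁ * d₄ * d) := hadm.squarefree
            obtain ⟨h43', -, -⟩ := Nat.squarefree_mul_iff.mp hsq'
            exact (Nat.Coprime.coprime_mul_left h43').symm
          rw [if_pos hadm, if_pos hcop, hdj]
          have h2j : (2 : ℝ) ^ j ≤ d := by
            have := Nat.pow_log_le_self 2 (Nat.one_le_iff_ne_zero.mp hd1)
            rw [hdj] at this
            exact_mod_cast this
          have hinv : ((d : ℝ) ^ 4)⁻¹ ≤ (((2 : ℝ) ^ j) ^ 4)⁻¹ :=
            inv_anti₀ (by positivity) (pow_le_pow_left₀ (by positivity) h2j 4)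
          calc ((d : ℝ) ^ 4)⁻¹ * (3 ^ d.primeFactors.card * ((divFam α (Y₀ / (4 : ℝ) ^ j) 1 d d₄.primeFactors ∅).ncard : ℝ))
              ≤ (((2 : ℝ) ^ j) ^ 4)⁻¹ * (C₃B * ((divFam α (Y₀ / (4 : ℝ) ^ j) 1 d d₄.primeFactors ∅).ncard : ℝ)) :=
                mul_le_mul hinv (mul_le_mul_of_nonneg_right (h3 d hdI) (Nat.cast_nonneg _)) (by positivity) (by positivity)
            _ = _ := by ring
        · rw [if_neg hadm]
          split_ifs
          · exact mul_nonneg (by positivity) (Nat.cast_nonneg _)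
          · simp
      calc ∑ d₃ ∈ (Finset.Icc 1 B).filter (fun d => Nat.log 2 d = j), (if Adm Q (c₂, c₁, d₄, d₃) then
            ((d₃ : ℝ) ^ 4)⁻¹ * (3 ^ d₃.primeFactors.card *
              ((divFam α (Y₀ / (4 : ℝ) ^ Nat.log 2 d₃) 1 d₃ d₄.primeFactors ∅).ncard : ℝ)) else 0)
          ≤ ∑ d₃ ∈ (Finset.Icc 1 B).filter (fun d => Nat.log 2 d = j), (((2 : ℝ) ^ j) ^ 4)⁻¹ * C₃B *
              (if d₃.Coprime d₄ then ((divFam α (Y₀ / (4 : ℝ) ^ j) 1 d₃ d₄.primeFactors ∅).ncard : ℝ) else 0) :=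
            Finset.sum_le_sum hterm
        _ = (((2 : ℝ) ^ j) ^ 4)⁻¹ * C₃B * blockSum α D (Y₀ / (4 : ℝ) ^ j) 1 d₄.primeFactors := by
            have hsf : ∑ d₃ ∈ (Finset.Icc 1 B).filter (fun d => Nat.log 2 d = j),
                (if d₃.Coprime d₄ then ((divFam α (Y₀ / (4 : ℝ) ^ j) 1 d₃ d₄.primeFactors ∅).ncard : ℝ) else 0) =
                ∑ d₃ ∈ D, ((divFam α (Y₀ / (4 : ℝ) ^ j) 1 d₃ d₄.primeFactors ∅).ncard : ℝ) := by
              rw [hD]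
              exact (Finset.sum_filter _ _).symm
            rw [← Finset.mul_sum, hsf, blockSum]
        _ ≤ (((2 : ℝ) ^ j) ^ 4)⁻¹ * C₃B * (A * 20 ^ d₄.primeFactors.card * (Y₀ / (4 : ℝ) ^ j) / (d₄ : ℝ) ^ 4) := by
            refine mul_le_mul_of_nonneg_left ?_ (by positivity)
            exact blockSum_le hδ hCδ hC hα hsq4 D (fun d hd => (Finset.mem_filter.mp hd).2) (by positivity)
              ((div_le_self hY₀0 (one_le_pow₀ (by norm_num))).trans hY₀N)
        _ = C₃B * A * 20 ^ d₄.primeFactors.card * (Y₀ / (d₄ : ℝ) ^ 4) * (((2 : ℝ) ^ j) ^ 6)⁻¹ := by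
            rw [show (4 : ℝ) ^ j = ((2 : ℝ) ^ j) ^ 2 by rw [← pow_mul, mul_comm, pow_mul]; norm_num]
            field_simp
        _ ≤ C₃B * A * 20 ^ d₄.primeFactors.card * (Y₀ / (d₄ : ℝ) ^ 4) * (12 * ((c₂ * c₁ * d₄ : ℕ) : ℝ) / Q) ^ 6 :=
            mul_le_mul_of_nonneg_left hj6 (by positivity)
        _ = E := by rw [hE]
    · have h0 : ∑ d₃ ∈ (Finset.Icc 1 B).filter (fun d => Nat.log 2 d = j), (if Adm Q (c₂, c₁, d₄, d₃) then
          ((d₃ : ℝ) ^ 4)⁻¹ * (3 ^ d₃.primeFactors.card *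
            ((divFam α (Y₀ / (4 : ℝ) ^ Nat.log 2 d₃) 1 d₃ d₄.primeFactors ∅).ncard : ℝ)) else 0) = 0 :=
        Finset.sum_eq_zero fun d hd => if_neg fun hadm => hex ⟨d, hd, hadm⟩
      rw [h0]
      exact hE0
  calc ∑ j ∈ Finset.range (Nat.log 2 B + 1), ∑ d₃ ∈ (Finset.Icc 1 B).filter (fun d => Nat.log 2 d = j),
        (if Adm Q (c₂, c₁, d₄, d₃) then ((d₃ : ℝ) ^ 4)⁻¹ * (3 ^ d₃.primeFactors.card *
          ((divFam α (Y₀ / (4 : ℝ) ^ Nat.log 2 d₃) 1 d₃ d₄.primeFactors ∅).ncard : ℝ)) else 0)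
      ≤ ∑ _j ∈ Finset.range (Nat.log 2 B + 1), E := Finset.sum_le_sum hfib
    _ = ((Nat.log 2 B + 1 : ℕ) : ℝ) * E := by rw [Finset.sum_const, Finset.card_range, nsmul_eq_mul]

/-- `Σ_a Σ_b Σ_c K/(abc) = K · (Σ 1/v)³`. [folklore] -/
theorem triple_sum_const_mul_inv (S : Finset ℕ) (K : ℝ) :
    ∑ a ∈ S, ∑ b ∈ S, ∑ c ∈ S, K * ((a : ℝ)⁻¹ * ((b : ℝ)⁻¹ * (c : ℝ)⁻¹)) = K * (∑ v ∈ S, (v : ℝ)⁻¹) ^ 3 := by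
  simp_rw [← Finset.mul_sum, ← Finset.sum_mul]
  ring

/-- **Small regime, all admissible types**:
`Σ_{τ adm} wt(τ) cnt(τ, N) ≤ 2(log₂B + 1) C₃ (2 C_δ N^δ C_U) C₉ C₂₀ 12⁶ (Σ_{v ≤ B} 1/v)³ · N/Q⁶`.
[cite: BhargavaTaniguchiThorne2023, §5 (eq. (42): "≪ N Q^{-6+ε} max(1, N^{-1/6} Q)" in the range N ≤ Q^{100})] -/
theorem sum_adm_weight_cnt_le {Cδ δ C_U : ℝ} (hδ : 0 < δ) (hCδ : ∀ n : ℕ, ((n.divisors.card : ℕ) : ℝ) ≤ Cδ * (n : ℝ) ^ δ)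
    (hC : ∀ q : ℕ, Squarefree q → ∀ s : ℤ, (s = 1 ∨ s = -1) → ∀ X : ℕ,
      (((∑ D ∈ (discWindow s X).filter (fun D => (q : ℤ) ^ 2 ∣ D), classNumber D : ℕ) : ℝ))
        ≤ C_U * 6 ^ q.primeFactors.card * X / (q : ℝ) ^ 2)
    {B : ℕ} {C₃B C₉B C₂₀B : ℝ} (hC₃0 : 0 ≤ C₃B) (h3 : ∀ d ∈ Finset.Icc 1 B, (3 : ℝ) ^ d.primeFactors.card ≤ C₃B)
    (h9 : ∀ d ∈ Finset.Icc 1 B, (9 : ℝ) ^ d.primeFactors.card ≤ C₉B)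
    (h20 : ∀ d ∈ Finset.Icc 1 B, (20 : ℝ) ^ d.primeFactors.card ≤ C₂₀B)
    {Q : ℕ} (hQ : 1 ≤ Q) {N : ℝ} (hN : 0 ≤ N) :
    ∑ τ ∈ tupleBox B, (if Adm Q τ then tupleWeight τ * cntBoth τ N else 0) ≤
      2 * ((Nat.log 2 B + 1 : ℕ) : ℝ) * C₃B * (2 * Cδ * N ^ δ * C_U) * C₉B * C₂₀B * 12 ^ 6 * N / (Q : ℝ) ^ 6 *
        (∑ v ∈ Finset.Icc 1 B, (v : ℝ)⁻¹) ^ 3 := by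
  have hCδ0 : 0 ≤ Cδ := by
    have h := hCδ 1; simp at h; linarith
  have hCU0 : 0 ≤ C_U := nonneg_of_uniformity_const hC
  have hNδ : 0 ≤ N ^ δ := Real.rpow_nonneg hN δ
  set L : ℝ := ((Nat.log 2 B + 1 : ℕ) : ℝ) with hL
  set A : ℝ := 2 * Cδ * N ^ δ * C_U with hA
  have hA0 : 0 ≤ A := by rw [hA]; exact mul_nonneg (mul_nonneg (mul_nonneg (by norm_num) hCδ0) hNδ) hCU0
  have hQ0 : (0 : ℝ) < Q := by exact_mod_cast hQ
  set K' : ℝ := 2 * L * C₃B * A * C₉B * C₂₀B * 12 ^ 6 * N / (Q : ℝ) ^ 6 with hK'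
  -- Step 2 (per `(c₂, c₁, d₄)`): the `d₃`-sum
  have hinner : ∀ c₂ ∈ Finset.Icc 1 B, ∀ c₁ ∈ Finset.Icc 1 B, ∀ d₄ ∈ Finset.Icc 1 B,
      ∑ d₃ ∈ Finset.Icc 1 B, (if Adm Q (c₂, c₁, d₄, d₃) then tupleWeight (c₂, c₁, d₄, d₃) * cntBoth (c₂, c₁, d₄, d₃) N else 0)
        ≤ K' * ((c₂ : ℝ)⁻¹ * ((c₁ : ℝ)⁻¹ * (d₄ : ℝ)⁻¹)) := by
    intro c₂ hc₂ c₁ hc₁ d₄ hd₄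
    have hc₂1 : 1 ≤ c₂ := (Finset.mem_Icc.mp hc₂).1
    have hc₁1 : 1 ≤ c₁ := (Finset.mem_Icc.mp hc₁).1
    have hd₄1 : 1 ≤ d₄ := (Finset.mem_Icc.mp hd₄).1
    have hc₂r : (1 : ℝ) ≤ c₂ := by exact_mod_cast hc₂1
    have hc₁r : (1 : ℝ) ≤ c₁ := by exact_mod_cast hc₁1
    have hd₄r : (1 : ℝ) ≤ d₄ := by exact_mod_cast hd₄1
    set Y₀ : ℝ := N / ((c₂ ^ 2 * c₁ : ℕ) : ℝ) ^ 4 with hY₀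
    -- the inner terms for each sign
    set g : ℤ → ℕ → ℝ := fun α d₃ => if Adm Q (c₂, c₁, d₄, d₃) then
        ((d₃ : ℝ) ^ 4)⁻¹ * (3 ^ d₃.primeFactors.card *
          ((divFam α (Y₀ / (4 : ℝ) ^ Nat.log 2 d₃) 1 d₃ d₄.primeFactors ∅).ncard : ℝ)) else 0 with hg
    have hpt : ∀ d₃ ∈ Finset.Icc 1 B,
        (if Adm Q (c₂, c₁, d₄, d₃) then tupleWeight (c₂, c₁, d₄, d₃) * cntBoth (c₂, c₁, d₄, d₃) N else 0) ≤
          9 ^ c₁.primeFactors.card * ((c₁ : ℝ) ^ 3)⁻¹ * ((d₄ : ℝ) ^ 3)⁻¹ * (g 1 d₃ + g (-1) d₃) := by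
      intro d₃ hd₃
      by_cases hadm : Adm Q (c₂, c₁, d₄, d₃)
      · have hsq : Squarefree (c₂ * c₁ * d₄ * d₃) := hadm.squarefree
        rw [if_pos hadm, hg]
        simp only [if_pos hadm]
        unfold tupleWeight cntBoth
        dsimp only
        have h1 := cnt_small_le (α := 1) hsq Y₀
        have h2 := cnt_small_le (α := -1) hsq Y₀
        rw [hY₀] at h1 h2 ⊢
        have hw : 0 ≤ (9 : ℝ) ^ c₁.primeFactors.card * ((c₁ : ℝ) ^ 3)⁻¹ * ((d₄ : ℝ) ^ 3)⁻¹ * ((d₃ : ℝ) ^ 4)⁻¹ := by positivity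
        calc 9 ^ c₁.primeFactors.card * ((c₁ : ℝ) ^ 3)⁻¹ * ((d₄ : ℝ) ^ 3)⁻¹ * ((d₃ : ℝ) ^ 4)⁻¹ *
              (((divFam 1 (N / ((c₂ ^ 2 * c₁ : ℕ) : ℝ) ^ 4) 1 1 d₄.primeFactors d₃.primeFactors).ncard : ℝ) +
                ((divFam (-1) (N / ((c₂ ^ 2 * c₁ : ℕ) : ℝ) ^ 4) 1 1 d₄.primeFactors d₃.primeFactors).ncard : ℝ))
            ≤ 9 ^ c₁.primeFactors.card * ((c₁ : ℝ) ^ 3)⁻¹ * ((d₄ : ℝ) ^ 3)⁻¹ * ((d₃ : ℝ) ^ 4)⁻¹ *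
              (3 ^ d₃.primeFactors.card * ((divFam 1 (N / ((c₂ ^ 2 * c₁ : ℕ) : ℝ) ^ 4 / (4 : ℝ) ^ Nat.log 2 d₃) 1 d₃
                  d₄.primeFactors ∅).ncard : ℝ) +
               3 ^ d₃.primeFactors.card * ((divFam (-1) (N / ((c₂ ^ 2 * c₁ : ℕ) : ℝ) ^ 4 / (4 : ℝ) ^ Nat.log 2 d₃) 1 d₃
                  d₄.primeFactors ∅).ncard : ℝ)) := mul_le_mul_of_nonneg_left (add_le_add h1 h2) hw
          _ = _ := by ring
      · rw [if_neg hadm, hg]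
        simp only [if_neg hadm, add_zero, mul_zero]
        rfl
    have hI1 := innerSum_le hδ hCδ hC hC₃0 h3 (α := 1) (Or.inl rfl) hQ hN hc₂1 hc₁1 hd₄1
    have hI2 := innerSum_le hδ hCδ hC hC₃0 h3 (α := -1) (Or.inr rfl) hQ hN hc₂1 hc₁1 hd₄1
    set E : ℝ := C₃B * (2 * Cδ * N ^ δ * C_U) * 20 ^ d₄.primeFactors.card *
      (N / ((c₂ ^ 2 * c₁ : ℕ) : ℝ) ^ 4 / (d₄ : ℝ) ^ 4) * (12 * ((c₂ * c₁ * d₄ : ℕ) : ℝ) / Q) ^ 6 with hE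
    have hsum1 : ∑ d₃ ∈ Finset.Icc 1 B, g 1 d₃ ≤ L * E := by rw [hg, hL, hE]; exact hI1
    have hsum2 : ∑ d₃ ∈ Finset.Icc 1 B, g (-1) d₃ ≤ L * E := by rw [hg, hL, hE]; exact hI2
    -- the algebra: weights × 2 L E ≤ K'/(c₂ c₁ d₄)
    have h9' : (9 : ℝ) ^ c₁.primeFactors.card ≤ C₉B := h9 c₁ hc₁
    have h20' : (20 : ℝ) ^ d₄.primeFactors.card ≤ C₂₀B := h20 d₄ hd₄
    have hC₉0 : 0 ≤ C₉B := le_trans (by positivity) h9'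
    have halg : 9 ^ c₁.primeFactors.card * ((c₁ : ℝ) ^ 3)⁻¹ * ((d₄ : ℝ) ^ 3)⁻¹ * (2 * (L * E)) ≤
        K' * ((c₂ : ℝ)⁻¹ * ((c₁ : ℝ)⁻¹ * (d₄ : ℝ)⁻¹)) := by
      have hid : 9 ^ c₁.primeFactors.card * ((c₁ : ℝ) ^ 3)⁻¹ * ((d₄ : ℝ) ^ 3)⁻¹ * (2 * (L * E)) =
          (2 * L * C₃B * A * 9 ^ c₁.primeFactors.card * 20 ^ d₄.primeFactors.card * 12 ^ 6 * N / (Q : ℝ) ^ 6) *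
            (((c₂ : ℝ) ^ 2)⁻¹ * ((c₁ : ℝ)⁻¹ * (d₄ : ℝ)⁻¹)) := by
        rw [hE, hA]; push_cast; field_simp
      rw [hid, hK']
      have hc2inv : ((c₂ : ℝ) ^ 2)⁻¹ ≤ (c₂ : ℝ)⁻¹ := inv_anti₀ (by positivity) (by nlinarith)
      have hC₂₀0 : 0 ≤ C₂₀B := le_trans (by positivity) h20'
      have hL0 : 0 ≤ L := by rw [hL]; positivity
      gcongr
    calc ∑ d₃ ∈ Finset.Icc 1 B, (if Adm Q (c₂, c₁, d₄, d₃) then tupleWeight (c₂, c₁, d₄, d₃) * cntBoth (c₂, c₁, d₄, d₃) N else 0)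
        ≤ ∑ d₃ ∈ Finset.Icc 1 B, 9 ^ c₁.primeFactors.card * ((c₁ : ℝ) ^ 3)⁻¹ * ((d₄ : ℝ) ^ 3)⁻¹ * (g 1 d₃ + g (-1) d₃) :=
          Finset.sum_le_sum hpt
      _ = 9 ^ c₁.primeFactors.card * ((c₁ : ℝ) ^ 3)⁻¹ * ((d₄ : ℝ) ^ 3)⁻¹ *
            (∑ d₃ ∈ Finset.Icc 1 B, g 1 d₃ + ∑ d₃ ∈ Finset.Icc 1 B, g (-1) d₃) := by
          rw [← Finset.mul_sum, Finset.sum_add_distrib]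
      _ ≤ 9 ^ c₁.primeFactors.card * ((c₁ : ℝ) ^ 3)⁻¹ * ((d₄ : ℝ) ^ 3)⁻¹ * (2 * (L * E)) := by
          refine mul_le_mul_of_nonneg_left ?_ (by positivity)
          linarith
      _ ≤ K' * ((c₂ : ℝ)⁻¹ * ((c₁ : ℝ)⁻¹ * (d₄ : ℝ)⁻¹)) := halg
  -- Step 3: sum over `(c₂, c₁, d₄)`
  have hexp : ∑ τ ∈ tupleBox B, (if Adm Q τ then tupleWeight τ * cntBoth τ N else 0) =
      ∑ c₂ ∈ Finset.Icc 1 B, ∑ c₁ ∈ Finset.Icc 1 B, ∑ d₄ ∈ Finset.Icc 1 B, ∑ d₃ ∈ Finset.Icc 1 B,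
        (if Adm Q (c₂, c₁, d₄, d₃) then tupleWeight (c₂, c₁, d₄, d₃) * cntBoth (c₂, c₁, d₄, d₃) N else 0) := by
    rw [tupleBox, Finset.sum_product]
    refine Finset.sum_congr rfl fun c₂ _ => ?_
    rw [Finset.sum_product]
    refine Finset.sum_congr rfl fun c₁ _ => ?_
    rw [Finset.sum_product]
  rw [hexp]
  calc ∑ c₂ ∈ Finset.Icc 1 B, ∑ c₁ ∈ Finset.Icc 1 B, ∑ d₄ ∈ Finset.Icc 1 B, ∑ d₃ ∈ Finset.Icc 1 B,
        (if Adm Q (c₂, c₁, d₄, d₃) then tupleWeight (c₂, c₁, d₄, d₃) * cntBoth (c₂, c₁, d₄, d₃) N else 0)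
      ≤ ∑ c₂ ∈ Finset.Icc 1 B, ∑ c₁ ∈ Finset.Icc 1 B, ∑ d₄ ∈ Finset.Icc 1 B, K' * ((c₂ : ℝ)⁻¹ * ((c₁ : ℝ)⁻¹ * (d₄ : ℝ)⁻¹)) :=
        Finset.sum_le_sum fun c₂ hc₂ => Finset.sum_le_sum fun c₁ hc₁ => Finset.sum_le_sum fun d₄ hd₄ =>
          hinner c₂ hc₂ c₁ hc₁ d₄ hd₄
    _ = K' * (∑ v ∈ Finset.Icc 1 B, (v : ℝ)⁻¹) ^ 3 := triple_sum_const_mul_inv _ _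
    _ = _ := by rw [hK']


end FinalTwo

/-! ### The supremum over `N` and the sum over `q` -/

section FinalThree

/-- `S_q(N) := Σ_{1 ≤ n < N} Σ_α Re a^α(|Φ̂_q|, n)`. [folklore] -/
def dualSum (q N : ℕ) : ℝ :=
  ∑ n ∈ Finset.Ico 1 N, ((dualAbsCoeff (psiMod q) 1 n).re + (dualAbsCoeff (psiMod q) (-1) n).re)

/-- `S_q(N) ≥ 0`. [folklore] -/
theorem dualSum_nonneg (q N : ℕ) : 0 ≤ dualSum q N :=
  Finset.sum_nonneg fun n _ => add_nonneg (dualAbsCoeff_re_nonneg _ _ n).1 (dualAbsCoeff_re_nonneg _ _ n).1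

/-- `S_q(N)` is monotone in `N`. [folklore] -/
theorem dualSum_mono (q : ℕ) {N N' : ℕ} (h : N ≤ N') : dualSum q N ≤ dualSum q N' :=
  Finset.sum_le_sum_of_subset_of_nonneg (Finset.Ico_subset_Ico_right h)
    fun n _ _ => add_nonneg (dualAbsCoeff_re_nonneg _ _ n).1 (dualAbsCoeff_re_nonneg _ _ n).1

/-- `δ̂₁(q) = (16q²)⁴ ⨆_N N⁻¹ S_q(N)` (definitional). [folklore] -/
theorem dualDensity_psiMod_eq (q : ℕ) :
    dualDensity (psiMod q) = ((16 * q ^ 2 : ℕ) : ℝ) ^ 4 * ⨆ N : ℕ, (N : ℝ)⁻¹ * dualSum q N := rfl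

/-- `S_q(N) ≤ Σ_{τ : ∏τ = u(q)} wt(τ) cnt(τ, N)` (the orbit-sum bound for `Φ_q`, given the Fourier majorant).
[cite: BhargavaTaniguchiThorne2023, §5 (eq. total_contribution)] -/
theorem dualSum_le_typeSum {q : ℕ} (hq : q ≠ 0)
    (hmaj : ∀ f : BinaryCubic ℤ, ‖dualWeight (psiMod q) f‖ ≤ ∏ p ∈ bigPrimes q, localMajorant p f)
    {B : ℕ} (hB : roughPart q ≤ B) (N : ℕ) :
    dualSum q N ≤ ∑ τ ∈ tupleBox B,
      (if τ.1 * τ.2.1 * τ.2.2.1 * τ.2.2.2 = roughPart q then tupleWeight τ else 0) * cntBoth τ N := by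
  haveI : NeZero (16 * q ^ 2) := ⟨by positivity⟩
  exact sum_re_dualAbsCoeff_le (Φ := psiMod q) (fun γ hγ y => psiMod_twist q hγ y) (P := bigPrimes q)
    (fun p hp => prime_of_mem_bigPrimes hp) hmaj hB N

/-- The large-regime constant `U(q) = τ(u)³ · 2 C_B 14^{ω(u)}/u⁷`. [folklore] -/
def largeConst (C_B : ℝ) (q : ℕ) : ℝ :=
  (((roughPart q).divisors.card : ℕ) : ℝ) ^ 3 * (2 * C_B * 14 ^ (roughPart q).primeFactors.card / ((roughPart q : ℕ) : ℝ) ^ 7)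

/-- `U(q) ≥ 0`. [folklore] -/
theorem largeConst_nonneg {C_B : ℝ} (hC : 0 ≤ C_B) (q : ℕ) : 0 ≤ largeConst C_B q := by
  unfold largeConst; positivity

/-- **The supremum over `N`, per `q`**: `N⁻¹ S_q(N) ≤ Σ_{j ≤ J₀} 2·2^{-j} S_q(2^j) + U(q)` (dyadic `N ≤ 2^{J₀}` by
monotonicity of `S_q`; `N ≥ 2^{J₀} ≥ K_B B^{35}` by the large regime). [folklore] -/
theorem inv_mul_dualSum_le {C_B K_B : ℝ} (hLT : DivCountBound C_B K_B) (hC : 0 ≤ C_B) (hK : 0 ≤ K_B)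
    {q : ℕ} (hq : q ≠ 0) (hmaj : ∀ f : BinaryCubic ℤ, ‖dualWeight (psiMod q) f‖ ≤ ∏ p ∈ bigPrimes q, localMajorant p f)
    {B : ℕ} (hB : roughPart q ≤ B) {J₀ : ℕ} (hJ₀ : K_B * (B : ℝ) ^ 35 ≤ (2 : ℝ) ^ J₀) (N : ℕ) :
    (N : ℝ)⁻¹ * dualSum q N ≤
      ∑ j ∈ Finset.range (J₀ + 1), 2 * ((2 : ℝ) ^ j)⁻¹ * dualSum q (2 ^ j) + largeConst C_B q := by
  have hsum0 : 0 ≤ ∑ j ∈ Finset.range (J₀ + 1), 2 * ((2 : ℝ) ^ j)⁻¹ * dualSum q (2 ^ j) :=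
    Finset.sum_nonneg fun j _ => mul_nonneg (by positivity) (dualSum_nonneg q _)
  have hU0 := largeConst_nonneg hC q
  rcases Nat.eq_zero_or_pos N with rfl | hN
  · simp only [Nat.cast_zero, inv_zero, zero_mul]
    positivity
  by_cases hsmall : Nat.log 2 N + 1 ≤ J₀
  · have hle : dualSum q N ≤ dualSum q (2 ^ (Nat.log 2 N + 1)) :=
      dualSum_mono q (Nat.lt_pow_succ_log_self one_lt_two N).le
    have hinv : (N : ℝ)⁻¹ ≤ 2 * ((2 : ℝ) ^ (Nat.log 2 N + 1))⁻¹ := by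
      have h2 : ((2 ^ Nat.log 2 N : ℕ) : ℝ) ≤ N := by exact_mod_cast Nat.pow_log_le_self 2 hN.ne'
      push_cast at h2
      have hN0 : (0 : ℝ) < N := by exact_mod_cast hN
      rw [pow_succ, mul_inv, show (2 : ℝ) * (((2 : ℝ) ^ Nat.log 2 N)⁻¹ * 2⁻¹) = ((2 : ℝ) ^ Nat.log 2 N)⁻¹ by ring]
      exact inv_anti₀ (by positivity) h2
    have h1 : (N : ℝ)⁻¹ * dualSum q N ≤ 2 * ((2 : ℝ) ^ (Nat.log 2 N + 1))⁻¹ * dualSum q (2 ^ (Nat.log 2 N + 1)) :=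
      mul_le_mul hinv hle (dualSum_nonneg q N) (by positivity)
    refine h1.trans ?_
    have hmem : Nat.log 2 N + 1 ∈ Finset.range (J₀ + 1) := Finset.mem_range.mpr (Nat.lt_succ_of_le hsmall)
    calc 2 * ((2 : ℝ) ^ (Nat.log 2 N + 1))⁻¹ * dualSum q (2 ^ (Nat.log 2 N + 1))
        ≤ ∑ j ∈ Finset.range (J₀ + 1), 2 * ((2 : ℝ) ^ j)⁻¹ * dualSum q (2 ^ j) :=
          Finset.single_le_sum (f := fun j => 2 * ((2 : ℝ) ^ j)⁻¹ * dualSum q (2 ^ j))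
            (fun j _ => mul_nonneg (by positivity) (dualSum_nonneg q _)) hmem
      _ ≤ _ := le_add_of_nonneg_right hU0
  · push Not at hsmall
    have hJ : J₀ ≤ Nat.log 2 N := Nat.lt_succ_iff.mp hsmall
    have hNge : (2 : ℝ) ^ J₀ ≤ N := by
      have h := (Nat.pow_le_pow_right two_pos hJ).trans (Nat.pow_log_le_self 2 hN.ne')
      exact_mod_cast h
    have hT := typeSum_large_le hLT hC hK q hB (hJ₀.trans hNge)
    have hS := dualSum_le_typeSum hq hmaj hB N
    have hN0 : (0 : ℝ) < N := by exact_mod_cast hN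
    have hSU : dualSum q N ≤ largeConst C_B q * N := by
      refine hS.trans (hT.trans_eq ?_)
      unfold largeConst
      ring
    calc (N : ℝ)⁻¹ * dualSum q N ≤ (N : ℝ)⁻¹ * (largeConst C_B q * N) := mul_le_mul_of_nonneg_left hSU (by positivity)
      _ = largeConst C_B q := by field_simp
      _ ≤ _ := le_add_of_nonneg_left hsum0

/-- Hence `δ̂₁(Φ_q) ≤ (16 q²)⁴ · (Σ_{j ≤ J₀} 2·2^{-j} S_q(2^j) + U(q))`. [folklore] -/
theorem dualDensity_psiMod_le {C_B K_B : ℝ} (hLT : DivCountBound C_B K_B) (hC : 0 ≤ C_B) (hK : 0 ≤ K_B)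
    {q : ℕ} (hq : q ≠ 0) (hmaj : ∀ f : BinaryCubic ℤ, ‖dualWeight (psiMod q) f‖ ≤ ∏ p ∈ bigPrimes q, localMajorant p f)
    {B : ℕ} (hB : roughPart q ≤ B) {J₀ : ℕ} (hJ₀ : K_B * (B : ℝ) ^ 35 ≤ (2 : ℝ) ^ J₀) :
    dualDensity (psiMod q) ≤ ((16 * q ^ 2 : ℕ) : ℝ) ^ 4 *
      (∑ j ∈ Finset.range (J₀ + 1), 2 * ((2 : ℝ) ^ j)⁻¹ * dualSum q (2 ^ j) + largeConst C_B q) := by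
  rw [dualDensity_psiMod_eq]
  exact mul_le_mul_of_nonneg_left (ciSup_le fun N => inv_mul_dualSum_le hLT hC hK hq hmaj hB hJ₀ N) (by positivity)

/-- **Large regime summed over `q`**: `Σ_{q ∈ [Q,2Q] sqfree} U(q) ≤ 4 C_τ³ C_B C₁₄ 6⁷/Q⁶`
(`u(q) ≥ Q/6`, at most `2Q` values of `q`). [cite: BhargavaTaniguchiThorne2023, §5 (N > Q^{100})] -/
theorem sum_largeConst_le {C_B : ℝ} (hC : 0 ≤ C_B) {Q : ℕ} (hQ : 1 ≤ Q) {CτB C₁₄B : ℝ}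
    (hτ : ∀ d ∈ Finset.Icc 1 (2 * Q), ((d.divisors.card : ℕ) : ℝ) ≤ CτB)
    (h14 : ∀ d ∈ Finset.Icc 1 (2 * Q), (14 : ℝ) ^ d.primeFactors.card ≤ C₁₄B) :
    ∑ q ∈ (Finset.Icc Q (2 * Q)).filter Squarefree, largeConst C_B q ≤ 4 * CτB ^ 3 * C_B * C₁₄B * 6 ^ 7 / (Q : ℝ) ^ 6 := by
  have hQ0 : (0 : ℝ) < Q := by exact_mod_cast hQ
  have hper : ∀ q ∈ (Finset.Icc Q (2 * Q)).filter Squarefree,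
      largeConst C_B q ≤ CτB ^ 3 * (2 * C_B * C₁₄B / ((Q : ℝ) / 6) ^ 7) := by
    intro q hq
    obtain ⟨hqI, hsq⟩ := Finset.mem_filter.mp hq
    obtain ⟨hQq, hq2⟩ := Finset.mem_Icc.mp hqI
    set u := roughPart q with hu
    have hu1 : 1 ≤ u := roughPart_pos q
    have huq : u ≤ q := Nat.le_of_dvd (Nat.pos_of_ne_zero hsq.ne_zero) (roughPart_dvd hsq)
    have humem : u ∈ Finset.Icc 1 (2 * Q) := Finset.mem_Icc.mpr ⟨hu1, huq.trans hq2⟩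
    have hQu : (Q : ℝ) / 6 ≤ u := by
      rw [div_le_iff₀ (by norm_num : (0 : ℝ) < 6)]
      have h := le_six_mul_roughPart hsq
      have : (Q : ℝ) ≤ ((6 * roughPart q : ℕ) : ℝ) := by exact_mod_cast hQq.trans h
      push_cast at this
      linarith
    have hτu : (((u.divisors.card : ℕ) : ℝ)) ≤ CτB := hτ u humem
    have h14u : (14 : ℝ) ^ u.primeFactors.card ≤ C₁₄B := h14 u humem
    have hC₁₄0 : 0 ≤ C₁₄B := le_trans (by positivity) h14u
    unfold largeConst
    rw [← hu]
    have hu7 : ((Q : ℝ) / 6) ^ 7 ≤ ((u : ℕ) : ℝ) ^ 7 := pow_le_pow_left₀ (by positivity) hQu 7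
    have hfrac : 2 * C_B * 14 ^ u.primeFactors.card / ((u : ℕ) : ℝ) ^ 7 ≤ 2 * C_B * C₁₄B / ((Q : ℝ) / 6) ^ 7 := by
      calc 2 * C_B * 14 ^ u.primeFactors.card / ((u : ℕ) : ℝ) ^ 7 ≤ 2 * C_B * C₁₄B / ((u : ℕ) : ℝ) ^ 7 := by
            gcongr
        _ ≤ 2 * C_B * C₁₄B / ((Q : ℝ) / 6) ^ 7 := div_le_div_of_nonneg_left (by positivity) (by positivity) hu7
    exact mul_le_mul (pow_le_pow_left₀ (Nat.cast_nonneg _) hτu 3) hfrac (by positivity)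
      (pow_nonneg (le_trans (Nat.cast_nonneg _) hτu) 3)
  have hcard : (((Finset.Icc Q (2 * Q)).filter Squarefree).card : ℝ) ≤ 2 * Q := by
    have h1 : ((Finset.Icc Q (2 * Q)).filter Squarefree).card ≤ (Finset.Icc Q (2 * Q)).card := Finset.card_filter_le _ _
    rw [Nat.card_Icc] at h1
    have : (((Finset.Icc Q (2 * Q)).filter Squarefree).card : ℝ) ≤ ((2 * Q + 1 - Q : ℕ) : ℝ) := by exact_mod_cast h1
    have h2 : ((2 * Q + 1 - Q : ℕ) : ℝ) = Q + 1 := by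
      rw [show 2 * Q + 1 - Q = Q + 1 by omega]; push_cast; ring
    have hQ1 : (1 : ℝ) ≤ Q := by exact_mod_cast hQ
    linarith
  have hCτ0 : 0 ≤ CτB := le_trans (Nat.cast_nonneg _) (hτ 1 (Finset.mem_Icc.mpr ⟨le_rfl, by omega⟩))
  have hC₁₄0 : 0 ≤ C₁₄B := le_trans (by positivity) (h14 1 (Finset.mem_Icc.mpr ⟨le_rfl, by omega⟩))
  calc ∑ q ∈ (Finset.Icc Q (2 * Q)).filter Squarefree, largeConst C_B q
      ≤ ∑ _q ∈ (Finset.Icc Q (2 * Q)).filter Squarefree, CτB ^ 3 * (2 * C_B * C₁₄B / ((Q : ℝ) / 6) ^ 7) :=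
        Finset.sum_le_sum hper
    _ = (((Finset.Icc Q (2 * Q)).filter Squarefree).card : ℝ) * (CτB ^ 3 * (2 * C_B * C₁₄B / ((Q : ℝ) / 6) ^ 7)) := by
        rw [Finset.sum_const, nsmul_eq_mul]
    _ ≤ (2 * Q) * (CτB ^ 3 * (2 * C_B * C₁₄B / ((Q : ℝ) / 6) ^ 7)) :=
        mul_le_mul_of_nonneg_right hcard (by positivity)
    _ = 4 * CτB ^ 3 * C_B * C₁₄B * 6 ^ 7 / (Q : ℝ) ^ 6 := by field_simp; ring

/-- **Small regime summed over `q`, at height `N`**: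
`Σ_{q} S_q(N) ≤ 6 · 2(log₂B+1) C₃ (2C_δ N^δ C_U) C₉ C₂₀ 12⁶ (Σ 1/v)³ N/Q⁶`.
[cite: BhargavaTaniguchiThorne2023, §5 (eq. bound_delta_2b, N ≤ Q^{100})] -/
theorem sum_dualSum_le_small {Cδ δ C_U : ℝ} (hδ : 0 < δ) (hCδ : ∀ n : ℕ, ((n.divisors.card : ℕ) : ℝ) ≤ Cδ * (n : ℝ) ^ δ)
    (hCU : ∀ q : ℕ, Squarefree q → ∀ s : ℤ, (s = 1 ∨ s = -1) → ∀ X : ℕ,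
      (((∑ D ∈ (discWindow s X).filter (fun D => (q : ℤ) ^ 2 ∣ D), classNumber D : ℕ) : ℝ))
        ≤ C_U * 6 ^ q.primeFactors.card * X / (q : ℝ) ^ 2)
    (hmaj : ∀ q : ℕ, Squarefree q → ∀ f : BinaryCubic ℤ, ‖dualWeight (psiMod q) f‖ ≤ ∏ p ∈ bigPrimes q, localMajorant p f)
    {Q : ℕ} (hQ : 1 ≤ Q) {C₃B C₉B C₂₀B : ℝ} (hC₃0 : 0 ≤ C₃B)
    (h3 : ∀ d ∈ Finset.Icc 1 (2 * Q), (3 : ℝ) ^ d.primeFactors.card ≤ C₃B)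
    (h9 : ∀ d ∈ Finset.Icc 1 (2 * Q), (9 : ℝ) ^ d.primeFactors.card ≤ C₉B)
    (h20 : ∀ d ∈ Finset.Icc 1 (2 * Q), (20 : ℝ) ^ d.primeFactors.card ≤ C₂₀B) (N : ℕ) :
    ∑ q ∈ (Finset.Icc Q (2 * Q)).filter Squarefree, dualSum q N ≤
      6 * (2 * ((Nat.log 2 (2 * Q) + 1 : ℕ) : ℝ) * C₃B * (2 * Cδ * (N : ℝ) ^ δ * C_U) * C₉B * C₂₀B * 12 ^ 6 * N / (Q : ℝ) ^ 6 *
        (∑ v ∈ Finset.Icc 1 (2 * Q), (v : ℝ)⁻¹) ^ 3) := by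
  have h1 : ∑ q ∈ (Finset.Icc Q (2 * Q)).filter Squarefree, dualSum q N ≤
      ∑ q ∈ (Finset.Icc Q (2 * Q)).filter Squarefree, ∑ τ ∈ tupleBox (2 * Q),
        (if τ.1 * τ.2.1 * τ.2.2.1 * τ.2.2.2 = roughPart q then tupleWeight τ * cntBoth τ N else 0) := by
    refine Finset.sum_le_sum fun q hq => ?_
    obtain ⟨hqI, hsq⟩ := Finset.mem_filter.mp hq
    have hB : roughPart q ≤ 2 * Q :=
      (Nat.le_of_dvd (Nat.pos_of_ne_zero hsq.ne_zero) (roughPart_dvd hsq)).trans (Finset.mem_Icc.mp hqI).2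
    refine (dualSum_le_typeSum hsq.ne_zero (hmaj q hsq) hB N).trans (le_of_eq ?_)
    refine Finset.sum_congr rfl fun τ _ => ?_
    split_ifs <;> simp
  refine h1.trans ((sum_q_typeSum_le Q (2 * Q) (fun τ => tupleWeight τ * cntBoth τ N)
    (fun τ => mul_nonneg (tupleWeight_nonneg τ) (cntBoth_nonneg τ N))).trans ?_)
  exact mul_le_mul_of_nonneg_left (sum_adm_weight_cnt_le hδ hCδ hCU hC₃0 h3 h9 h20 hQ (Nat.cast_nonneg N)) (by norm_num)

end FinalThree

/-! ### The master inequality and the `ε`-bookkeeping -/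

section FinalFour

/-- **The master inequality at scale `Q`** (both regimes, the supremum over `N`, the level factor
`(16q²)⁴ ≤ (16B²)⁴`, `B = 2Q`). [cite: BhargavaTaniguchiThorne2023, §5 (proof of Prop. 5.1)] -/
theorem sum_dualDensity_le_master {C_B K_B : ℝ} (hLT : DivCountBound C_B K_B) (hC : 0 ≤ C_B) (hK : 0 ≤ K_B)
    {Cδ δ C_U : ℝ} (hδ : 0 < δ) (hCδ : ∀ n : ℕ, ((n.divisors.card : ℕ) : ℝ) ≤ Cδ * (n : ℝ) ^ δ)
    (hCU : ∀ q : ℕ, Squarefree q → ∀ s : ℤ, (s = 1 ∨ s = -1) → ∀ X : ℕ,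
      (((∑ D ∈ (discWindow s X).filter (fun D => (q : ℤ) ^ 2 ∣ D), classNumber D : ℕ) : ℝ))
        ≤ C_U * 6 ^ q.primeFactors.card * X / (q : ℝ) ^ 2)
    (hmaj : ∀ q : ℕ, Squarefree q → ∀ f : BinaryCubic ℤ, ‖dualWeight (psiMod q) f‖ ≤ ∏ p ∈ bigPrimes q, localMajorant p f)
    {Q : ℕ} (hQ : 1 ≤ Q) {C₃B C₉B C₂₀B CτB C₁₄B : ℝ} (hC₃0 : 0 ≤ C₃B)
    (h3 : ∀ d ∈ Finset.Icc 1 (2 * Q), (3 : ℝ) ^ d.primeFactors.card ≤ C₃B)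
    (h9 : ∀ d ∈ Finset.Icc 1 (2 * Q), (9 : ℝ) ^ d.primeFactors.card ≤ C₉B)
    (h20 : ∀ d ∈ Finset.Icc 1 (2 * Q), (20 : ℝ) ^ d.primeFactors.card ≤ C₂₀B)
    (hτ : ∀ d ∈ Finset.Icc 1 (2 * Q), ((d.divisors.card : ℕ) : ℝ) ≤ CτB)
    (h14 : ∀ d ∈ Finset.Icc 1 (2 * Q), (14 : ℝ) ^ d.primeFactors.card ≤ C₁₄B)
    {J₀ : ℕ} (hJ₀ : K_B * ((2 * Q : ℕ) : ℝ) ^ 35 ≤ (2 : ℝ) ^ J₀) :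
    ∑ q ∈ (Finset.Icc Q (2 * Q)).filter Squarefree, dualDensity (psiMod q) ≤
      ((16 * (2 * Q) ^ 2 : ℕ) : ℝ) ^ 4 *
        (∑ j ∈ Finset.range (J₀ + 1), 2 * ((2 : ℝ) ^ j)⁻¹ *
          (6 * (2 * ((Nat.log 2 (2 * Q) + 1 : ℕ) : ℝ) * C₃B * (2 * Cδ * (((2 ^ j : ℕ) : ℕ) : ℝ) ^ δ * C_U) * C₉B * C₂₀B *
            12 ^ 6 * ((2 ^ j : ℕ) : ℝ) / (Q : ℝ) ^ 6 * (∑ v ∈ Finset.Icc 1 (2 * Q), (v : ℝ)⁻¹) ^ 3)) +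
         4 * CτB ^ 3 * C_B * C₁₄B * 6 ^ 7 / (Q : ℝ) ^ 6) := by
  set Sq := (Finset.Icc Q (2 * Q)).filter Squarefree with hSq
  set M : ℝ := ((16 * (2 * Q) ^ 2 : ℕ) : ℝ) ^ 4 with hM
  -- per `q`
  have hper : ∀ q ∈ Sq, dualDensity (psiMod q) ≤
      M * (∑ j ∈ Finset.range (J₀ + 1), 2 * ((2 : ℝ) ^ j)⁻¹ * dualSum q (2 ^ j) + largeConst C_B q) := by
    intro q hq
    obtain ⟨hqI, hsq⟩ := Finset.mem_filter.mp hq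
    have hq2 : q ≤ 2 * Q := (Finset.mem_Icc.mp hqI).2
    have hB : roughPart q ≤ 2 * Q := (Nat.le_of_dvd (Nat.pos_of_ne_zero hsq.ne_zero) (roughPart_dvd hsq)).trans hq2
    have h := dualDensity_psiMod_le hLT hC hK hsq.ne_zero (hmaj q hsq) hB hJ₀
    refine h.trans (mul_le_mul_of_nonneg_right ?_ ?_)
    · rw [hM]
      exact_mod_cast Nat.pow_le_pow_left (Nat.mul_le_mul_left 16 (Nat.pow_le_pow_left hq2 2)) 4
    · exact add_nonneg (Finset.sum_nonneg fun j _ => mul_nonneg (by positivity) (dualSum_nonneg q _))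
        (largeConst_nonneg hC q)
  calc ∑ q ∈ Sq, dualDensity (psiMod q)
      ≤ ∑ q ∈ Sq, M * (∑ j ∈ Finset.range (J₀ + 1), 2 * ((2 : ℝ) ^ j)⁻¹ * dualSum q (2 ^ j) + largeConst C_B q) :=
        Finset.sum_le_sum hper
    _ = M * (∑ j ∈ Finset.range (J₀ + 1), 2 * ((2 : ℝ) ^ j)⁻¹ * ∑ q ∈ Sq, dualSum q (2 ^ j) +
          ∑ q ∈ Sq, largeConst C_B q) := by
        rw [← Finset.mul_sum, Finset.sum_add_distrib, Finset.sum_comm]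
        congr 2
        refine Finset.sum_congr rfl fun j _ => ?_
        rw [Finset.mul_sum]
    _ ≤ _ := by
        refine mul_le_mul_of_nonneg_left (add_le_add (Finset.sum_le_sum fun j _ => ?_) ?_) (by positivity)
        · refine mul_le_mul_of_nonneg_left ?_ (by positivity)
          have h := sum_dualSum_le_small hδ hCδ hCU hmaj hQ hC₃0 h3 h9 h20 (2 ^ j)
          exact h
        · exact sum_largeConst_le hC hQ hτ h14

/-- `⌊log₂ n⌋ ≤ n^δ/(δ log 2)`. [folklore] -/
theorem natLog_two_le_rpow_div {δ : ℝ} (hδ : 0 < δ) (n : ℕ) : (Nat.log 2 n : ℝ) ≤ (n : ℝ) ^ δ / (δ * Real.log 2) := by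
  have hlog2 : 0 < Real.log 2 := Real.log_pos one_lt_two
  rcases Nat.eq_zero_or_pos n with rfl | hn
  · simp [Real.zero_rpow hδ.ne']
  have h2 : ((2 ^ Nat.log 2 n : ℕ) : ℝ) ≤ n := by exact_mod_cast Nat.pow_log_le_self 2 hn.ne'
  push_cast at h2
  have hn0 : (0 : ℝ) < n := by exact_mod_cast hn
  have h3 : (Nat.log 2 n : ℝ) * Real.log 2 ≤ Real.log n := by
    rw [← Real.log_pow]
    exact Real.log_le_log (by positivity) h2
  have h4 : Real.log n ≤ (n : ℝ) ^ δ / δ := Real.log_le_rpow_div hn0.le hδ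
  rw [le_div_iff₀ (by positivity)]
  calc (Nat.log 2 n : ℝ) * (δ * Real.log 2) = δ * ((Nat.log 2 n : ℝ) * Real.log 2) := by ring
    _ ≤ δ * ((n : ℝ) ^ δ / δ) := mul_le_mul_of_nonneg_left (h3.trans h4) hδ.le
    _ = (n : ℝ) ^ δ := by field_simp

/-- `1 + log B ≤ (1 + 1/δ) B^δ` for `B ≥ 1`. [folklore] -/
theorem one_add_log_le_rpow {δ : ℝ} (hδ : 0 < δ) {B : ℝ} (hB : 1 ≤ B) : 1 + Real.log B ≤ (1 + 1 / δ) * B ^ δ := by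
  have h1 : (1 : ℝ) ≤ B ^ δ := Real.one_le_rpow hB hδ.le
  have h2 : Real.log B ≤ B ^ δ / δ := Real.log_le_rpow_div (by linarith) hδ
  calc 1 + Real.log B ≤ B ^ δ + B ^ δ / δ := add_le_add h1 h2
    _ = (1 + 1 / δ) * B ^ δ := by ring

/-- `(x^k)^δ = (x^δ)^k` for `x ≥ 0`. [folklore] -/
theorem rpow_pow_comm {x : ℝ} (hx : 0 ≤ x) (k : ℕ) (δ : ℝ) : (x ^ k) ^ δ = (x ^ δ) ^ k := by
  rw [← Real.rpow_natCast, ← Real.rpow_mul hx, mul_comm, Real.rpow_mul hx, Real.rpow_natCast]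

/-- The algebra of one dyadic term (atoms only). [folklore] -/
theorem dyadicTerm_identity (P L c3 cd x cu c9 c20 H Q6 : ℝ) (hP : P ≠ 0) (hQ : Q6 ≠ 0) :
    2 * P⁻¹ * (6 * (2 * L * c3 * (2 * cd * x * cu) * c9 * c20 * 12 ^ 6 * P / Q6 * H ^ 3)) =
      48 * 12 ^ 6 / Q6 * (c3 * cd * cu * c9 * c20) * (L * x * H ^ 3) := by
  field_simp
  ring

/-- **BTT Proposition 5.1 from its inputs.** Given Prop. 4.5 (`btt_uniformity_sqDvd`), the large-height divisibility
count `DivCountBound C_B K_B` (Thm 2.4 (ii), (iii) + Thm 3.2) and the local Fourier majorants of Prop. 5.2 for the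
`Φ_q` (`hmaj`), for every `ε > 0` there is `C` with `Σ_{q ∈ [Q,2Q] sqfree} δ̂₁(Φ_q) ≤ C Q^{2+ε}`.
[cite: BhargavaTaniguchiThorne2023, Proposition 5.1] -/
theorem dualDensityPsiBound_of_divCountBound (hU : btt_uniformity_sqDvd) {C_B K_B : ℝ} (hC : 0 ≤ C_B) (hK : 0 ≤ K_B)
    (hLT : DivCountBound C_B K_B)
    (hmaj : ∀ q : ℕ, Squarefree q → ∀ f : BinaryCubic ℤ, ‖dualWeight (psiMod q) f‖ ≤ ∏ p ∈ bigPrimes q, localMajorant p f)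
    {ε : ℝ} (hε : 0 < ε) : ∃ C : ℝ, DualDensityPsiBound ε C := by
  -- the auxiliary exponent and the constants
  obtain ⟨δ, hδdef⟩ : ∃ δ : ℝ, δ = ε / 43 := ⟨_, rfl⟩
  have hδ : 0 < δ := by rw [hδdef]; positivity
  have hlog2 : 0 < Real.log 2 := Real.log_pos one_lt_two
  obtain ⟨C_U, hCU⟩ := hU
  have hCU0 : 0 ≤ C_U := nonneg_of_uniformity_const hCU
  obtain ⟨Cδ, hCδ1, hCδ⟩ := Literature.NumberTheory.Sieve.exists_card_divisors_le_mul_rpow' hδ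
  have hCδ0 : 0 ≤ Cδ := by linarith
  obtain ⟨C₃, hC₃0, hC₃⟩ := pow_card_primeFactors_le_rpow (K := 3) (by norm_num) hδ
  obtain ⟨C₉, hC₉0, hC₉⟩ := pow_card_primeFactors_le_rpow (K := 9) (by norm_num) hδ
  obtain ⟨C₂₀, hC₂₀0, hC₂₀⟩ := pow_card_primeFactors_le_rpow (K := 20) (by norm_num) hδ
  obtain ⟨C₁₄, hC₁₄0, hC₁₄⟩ := pow_card_primeFactors_le_rpow (K := 14) (by norm_num) hδ
  obtain ⟨a₁, ha₁⟩ : ∃ a : ℝ, a = 1 / (δ * Real.log 2) + 1 := ⟨_, rfl⟩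
  obtain ⟨a₂, ha₂⟩ : ∃ a : ℝ, a = (2 * (K_B + 2)) ^ δ := ⟨_, rfl⟩
  obtain ⟨a₃, ha₃⟩ : ∃ a : ℝ, a = 1 + 1 / δ := ⟨_, rfl⟩
  obtain ⟨a₄, ha₄⟩ : ∃ a : ℝ, a = (K_B + 1) ^ (δ / 35) * (35 / (δ * Real.log 2)) + 2 := ⟨_, rfl⟩
  have ha₁0 : 0 ≤ a₁ := by rw [ha₁]; positivity
  have ha₂0 : 0 ≤ a₂ := by rw [ha₂]; positivity
  have ha₃0 : 0 ≤ a₃ := by rw [ha₃]; positivity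
  have ha₄0 : 0 ≤ a₄ := by rw [ha₄]; positivity
  obtain ⟨K₁, hK₁⟩ : ∃ K : ℝ, K = 48 * 12 ^ 6 * a₁ * C₃ * Cδ * a₂ * C_U * C₉ * C₂₀ * a₃ ^ 3 * a₄ := ⟨_, rfl⟩
  obtain ⟨K₂, hK₂⟩ : ∃ K : ℝ, K = 4 * 6 ^ 7 * Cδ ^ 3 * C_B * C₁₄ := ⟨_, rfl⟩
  have hK₁0 : 0 ≤ K₁ := by rw [hK₁]; positivity
  have hK₂0 : 0 ≤ K₂ := by rw [hK₂]; positivity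
  refine ⟨2 ^ 24 * (K₁ + K₂) * 2 ^ ε, fun Q hQ => ?_⟩
  -- the scale
  set B : ℕ := 2 * Q with hBdef
  have hB1 : 1 ≤ B := by rw [hBdef]; omega
  have hBr1 : (1 : ℝ) ≤ B := by exact_mod_cast hB1
  have hBr0 : (0 : ℝ) ≤ B := by linarith
  have hQ0 : (0 : ℝ) < Q := by exact_mod_cast hQ
  obtain ⟨t, ht⟩ : ∃ t : ℝ, t = (B : ℝ) ^ δ := ⟨_, rfl⟩
  have ht1 : 1 ≤ t := ht ▸ Real.one_le_rpow hBr1 hδ.le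
  have ht0 : 0 ≤ t := by linarith
  -- constants over `[1, B]`
  have hmonoK : ∀ {K C : ℝ}, 0 < C → (∀ q : ℕ, 1 ≤ q → K ^ q.primeFactors.card ≤ C * (q : ℝ) ^ δ) →
      ∀ d ∈ Finset.Icc 1 B, K ^ d.primeFactors.card ≤ C * t := by
    intro K C hC0 h d hd
    obtain ⟨hd1, hdB⟩ := Finset.mem_Icc.mp hd
    refine (h d hd1).trans (mul_le_mul_of_nonneg_left ?_ hC0.le)
    rw [ht]
    exact Real.rpow_le_rpow (by positivity) (by exact_mod_cast hdB) hδ.le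
  have h3 := hmonoK hC₃0 hC₃
  have h9 := hmonoK hC₉0 hC₉
  have h20 := hmonoK hC₂₀0 hC₂₀
  have h14 := hmonoK hC₁₄0 hC₁₄
  have hτ : ∀ d ∈ Finset.Icc 1 B, ((d.divisors.card : ℕ) : ℝ) ≤ Cδ * t := by
    intro d hd
    obtain ⟨-, hdB⟩ := Finset.mem_Icc.mp hd
    rw [ht]
    exact (hCδ d).trans (mul_le_mul_of_nonneg_left (Real.rpow_le_rpow (by positivity) (by exact_mod_cast hdB) hδ.le) hCδ0)
  -- `J₀`
  obtain ⟨n, hn⟩ : ∃ n : ℕ, n = ⌈K_B * (B : ℝ) ^ 35⌉₊ := ⟨_, rfl⟩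
  obtain ⟨J₀, hJ₀def⟩ : ∃ J : ℕ, J = Nat.log 2 n + 1 := ⟨_, rfl⟩
  have hJ₀ : K_B * ((2 * Q : ℕ) : ℝ) ^ 35 ≤ (2 : ℝ) ^ J₀ := by
    have h1 : K_B * (B : ℝ) ^ 35 ≤ n := hn ▸ Nat.le_ceil _
    have h2 : n < 2 ^ J₀ := hJ₀def ▸ Nat.lt_pow_succ_log_self one_lt_two n
    have h3' : (n : ℝ) ≤ (2 : ℝ) ^ J₀ := by exact_mod_cast h2.le
    rw [← hBdef]
    exact h1.trans h3'
  have hnle : (n : ℝ) ≤ (K_B + 1) * (B : ℝ) ^ 35 := by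
    have h1 : (n : ℝ) < K_B * (B : ℝ) ^ 35 + 1 := hn ▸ Nat.ceil_lt_add_one (by positivity)
    have h2 : (1 : ℝ) ≤ (B : ℝ) ^ 35 := one_le_pow₀ hBr1
    nlinarith
  -- (d) `L ≤ a₁ t`
  have hL : ((Nat.log 2 B + 1 : ℕ) : ℝ) ≤ a₁ * t := by
    have h := natLog_two_le_rpow_div hδ B
    push_cast
    rw [ha₁, add_mul, one_mul]
    refine add_le_add ?_ ht1
    rw [ht, div_mul_eq_mul_div, one_mul]
    exact h
  -- (e) `H ≤ a₃ t`
  have hH : ∑ v ∈ Finset.Icc 1 B, (v : ℝ)⁻¹ ≤ a₃ * t := by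
    rw [ha₃, ht]
    -- Mathlib's harmonic bound `Σ_{v ≤ B} 1/v ≤ 1 + log B`, cast from `ℚ`
    have hharm : ∑ v ∈ Finset.Icc 1 B, (v : ℝ)⁻¹ ≤ 1 + Real.log B := by
      have h := harmonic_le_one_add_log B
      rw [harmonic_eq_sum_Icc, Rat.cast_sum] at h
      simpa only [Rat.cast_inv, Rat.cast_natCast] using h
    exact hharm.trans (one_add_log_le_rpow hδ hBr1)
  have hH0 : 0 ≤ ∑ v ∈ Finset.Icc 1 B, (v : ℝ)⁻¹ := Finset.sum_nonneg fun v _ => by positivity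
  -- (f) `J₀ + 1 ≤ a₄ t`
  have hJ₀1 : ((J₀ + 1 : ℕ) : ℝ) ≤ a₄ * t := by
    have hδ35 : 0 < δ / 35 := by positivity
    have h1 := natLog_two_le_rpow_div hδ35 n
    have h2 : (n : ℝ) ^ (δ / 35) ≤ (K_B + 1) ^ (δ / 35) * t := by
      calc (n : ℝ) ^ (δ / 35) ≤ ((K_B + 1) * (B : ℝ) ^ 35) ^ (δ / 35) := Real.rpow_le_rpow (Nat.cast_nonneg _) hnle hδ35.le
        _ = (K_B + 1) ^ (δ / 35) * ((B : ℝ) ^ 35) ^ (δ / 35) := Real.mul_rpow (by positivity) (by positivity)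
        _ = (K_B + 1) ^ (δ / 35) * t := by
            have he : ((35 : ℕ) : ℝ) * (δ / 35) = δ := by push_cast; ring
            rw [ht, ← Real.rpow_natCast (B : ℝ) 35, ← Real.rpow_mul hBr0, he]
    rw [hJ₀def]
    push_cast
    rw [ha₄, add_mul]
    have h3' : (Nat.log 2 n : ℝ) ≤ (K_B + 1) ^ (δ / 35) * (35 / (δ * Real.log 2)) * t := by
      refine h1.trans ?_
      rw [div_le_iff₀ (by positivity)]
      calc (n : ℝ) ^ (δ / 35) ≤ (K_B + 1) ^ (δ / 35) * t := h2
        _ = (K_B + 1) ^ (δ / 35) * (35 / (δ * Real.log 2)) * t * (δ / 35 * Real.log 2) := by field_simp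
    nlinarith
  -- (g) `(2^j)^δ ≤ a₂ t^35` for `j ≤ J₀`
  have hlogn : 2 ^ Nat.log 2 n ≤ n + 1 := by
    rcases Nat.eq_zero_or_pos n with h0 | hn0
    · rw [h0, Nat.log_zero_right, pow_zero]
      norm_num
    · exact (Nat.pow_log_le_self 2 hn0.ne').trans (Nat.le_succ n)
  have h2J₀ : ((2 ^ J₀ : ℕ) : ℝ) ≤ 2 * (K_B + 2) * (B : ℝ) ^ 35 := by
    have h2 : 2 ^ J₀ ≤ (n + 1) * 2 := by
      rw [hJ₀def, pow_succ]
      exact Nat.mul_le_mul_right 2 hlogn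
    have h3' : ((2 ^ J₀ : ℕ) : ℝ) ≤ ((n : ℝ) + 1) * 2 := by exact_mod_cast h2
    have hB35 : (1 : ℝ) ≤ (B : ℝ) ^ 35 := one_le_pow₀ hBr1
    have h4 : (n : ℝ) + 1 ≤ (K_B + 2) * (B : ℝ) ^ 35 := by linarith
    calc ((2 ^ J₀ : ℕ) : ℝ) ≤ ((n : ℝ) + 1) * 2 := h3'
      _ ≤ (K_B + 2) * (B : ℝ) ^ 35 * 2 := mul_le_mul_of_nonneg_right h4 (by norm_num)
      _ = 2 * (K_B + 2) * (B : ℝ) ^ 35 := by ring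
  have h2J : ∀ j ∈ Finset.range (J₀ + 1), (((2 ^ j : ℕ) : ℕ) : ℝ) ^ δ ≤ a₂ * t ^ 35 := by
    intro j hj
    have hjJ : j ≤ J₀ := Nat.lt_succ_iff.mp (Finset.mem_range.mp hj)
    have h1 : ((2 ^ j : ℕ) : ℝ) ≤ ((2 ^ J₀ : ℕ) : ℝ) := by exact_mod_cast Nat.pow_le_pow_right two_pos hjJ
    have hpow : ((2 ^ j : ℕ) : ℝ) ≤ 2 * (K_B + 2) * (B : ℝ) ^ 35 := h1.trans h2J₀
    have hsplit : (2 * (K_B + 2) * (B : ℝ) ^ 35) ^ δ = (2 * (K_B + 2)) ^ δ * ((B : ℝ) ^ 35) ^ δ :=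
      Real.mul_rpow (x := 2 * (K_B + 2)) (y := (B : ℝ) ^ 35) (by positivity) (by positivity)
    calc (((2 ^ j : ℕ) : ℕ) : ℝ) ^ δ ≤ (2 * (K_B + 2) * (B : ℝ) ^ 35) ^ δ := Real.rpow_le_rpow (Nat.cast_nonneg _) hpow hδ.le
      _ = (2 * (K_B + 2)) ^ δ * ((B : ℝ) ^ 35) ^ δ := hsplit
      _ = a₂ * t ^ 35 := by rw [ha₂, rpow_pow_comm hBr0 35 δ, ht]
  -- the master inequality
  have hmaster := sum_dualDensity_le_master hLT hC hK hδ hCδ hCU hmaj hQ (C₃B := C₃ * t) (C₉B := C₉ * t)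
    (C₂₀B := C₂₀ * t) (CτB := Cδ * t) (C₁₄B := C₁₄ * t) (by positivity) h3 h9 h20 hτ h14 hJ₀
  -- bound the bracket
  have hterm : ∀ j ∈ Finset.range (J₀ + 1), 2 * ((2 : ℝ) ^ j)⁻¹ *
      (6 * (2 * ((Nat.log 2 (2 * Q) + 1 : ℕ) : ℝ) * (C₃ * t) * (2 * Cδ * (((2 ^ j : ℕ) : ℕ) : ℝ) ^ δ * C_U) * (C₉ * t) *
        (C₂₀ * t) * 12 ^ 6 * ((2 ^ j : ℕ) : ℝ) / (Q : ℝ) ^ 6 * (∑ v ∈ Finset.Icc 1 (2 * Q), (v : ℝ)⁻¹) ^ 3)) ≤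
      48 * 12 ^ 6 * a₁ * C₃ * Cδ * a₂ * C_U * C₉ * C₂₀ * a₃ ^ 3 * t ^ 42 / (Q : ℝ) ^ 6 := by
    intro j hj
    rw [← hBdef]
    have hx := h2J j hj
    have hL' := hL
    push_cast at hx hL' ⊢
    rw [dyadicTerm_identity ((2 : ℝ) ^ j) ((Nat.log 2 B : ℝ) + 1) (C₃ * t) Cδ (((2 : ℝ) ^ j) ^ δ) C_U (C₉ * t) (C₂₀ * t)
      (∑ v ∈ Finset.Icc 1 B, (v : ℝ)⁻¹) ((Q : ℝ) ^ 6) (by positivity) (by positivity)]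
    have hx0 : 0 ≤ ((2 : ℝ) ^ j) ^ δ := Real.rpow_nonneg (by positivity) δ
    have ha₁t : 0 ≤ a₁ * t := le_trans (by positivity) hL'
    have hvar : ((Nat.log 2 B : ℝ) + 1) * ((2 : ℝ) ^ j) ^ δ * (∑ v ∈ Finset.Icc 1 B, (v : ℝ)⁻¹) ^ 3 ≤
        (a₁ * t) * (a₂ * t ^ 35) * (a₃ * t) ^ 3 :=
      mul_le_mul (mul_le_mul hL' hx hx0 ha₁t) (pow_le_pow_left₀ hH0 hH 3) (by positivity) (by positivity)
    have hcommon : 0 ≤ 48 * 12 ^ 6 / (Q : ℝ) ^ 6 * (C₃ * t * Cδ * C_U * (C₉ * t) * (C₂₀ * t)) := by positivity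
    calc 48 * 12 ^ 6 / (Q : ℝ) ^ 6 * (C₃ * t * Cδ * C_U * (C₉ * t) * (C₂₀ * t)) *
          (((Nat.log 2 B : ℝ) + 1) * ((2 : ℝ) ^ j) ^ δ * (∑ v ∈ Finset.Icc 1 B, (v : ℝ)⁻¹) ^ 3)
        ≤ 48 * 12 ^ 6 / (Q : ℝ) ^ 6 * (C₃ * t * Cδ * C_U * (C₉ * t) * (C₂₀ * t)) * ((a₁ * t) * (a₂ * t ^ 35) * (a₃ * t) ^ 3) :=
          mul_le_mul_of_nonneg_left hvar hcommon
      _ = 48 * 12 ^ 6 * a₁ * C₃ * Cδ * a₂ * C_U * C₉ * C₂₀ * a₃ ^ 3 * t ^ 42 / (Q : ℝ) ^ 6 := by ring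
  have hsum : ∑ j ∈ Finset.range (J₀ + 1), 2 * ((2 : ℝ) ^ j)⁻¹ *
      (6 * (2 * ((Nat.log 2 (2 * Q) + 1 : ℕ) : ℝ) * (C₃ * t) * (2 * Cδ * (((2 ^ j : ℕ) : ℕ) : ℝ) ^ δ * C_U) * (C₉ * t) *
        (C₂₀ * t) * 12 ^ 6 * ((2 ^ j : ℕ) : ℝ) / (Q : ℝ) ^ 6 * (∑ v ∈ Finset.Icc 1 (2 * Q), (v : ℝ)⁻¹) ^ 3)) ≤
      K₁ * t ^ 43 / (Q : ℝ) ^ 6 := by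
    refine (Finset.sum_le_sum hterm).trans ?_
    rw [Finset.sum_const, Finset.card_range, nsmul_eq_mul]
    calc ((J₀ + 1 : ℕ) : ℝ) * (48 * 12 ^ 6 * a₁ * C₃ * Cδ * a₂ * C_U * C₉ * C₂₀ * a₃ ^ 3 * t ^ 42 / (Q : ℝ) ^ 6)
        ≤ (a₄ * t) * (48 * 12 ^ 6 * a₁ * C₃ * Cδ * a₂ * C_U * C₉ * C₂₀ * a₃ ^ 3 * t ^ 42 / (Q : ℝ) ^ 6) :=
          mul_le_mul_of_nonneg_right hJ₀1 (by positivity)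
      _ = K₁ * t ^ 43 / (Q : ℝ) ^ 6 := by rw [hK₁]; ring
  have hlarge : 4 * (Cδ * t) ^ 3 * C_B * (C₁₄ * t) * 6 ^ 7 / (Q : ℝ) ^ 6 ≤ K₂ * t ^ 43 / (Q : ℝ) ^ 6 := by
    rw [div_le_div_iff_of_pos_right (by positivity), hK₂]
    have ht4 : t ^ 4 ≤ t ^ 43 := pow_le_pow_right₀ ht1 (by norm_num)
    calc 4 * (Cδ * t) ^ 3 * C_B * (C₁₄ * t) * 6 ^ 7 = 4 * 6 ^ 7 * Cδ ^ 3 * C_B * C₁₄ * t ^ 4 := by ring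
      _ ≤ 4 * 6 ^ 7 * Cδ ^ 3 * C_B * C₁₄ * t ^ 43 := mul_le_mul_of_nonneg_left ht4 (by positivity)
  -- the level factor and the final power of `Q`
  have hM : ((16 * (2 * Q) ^ 2 : ℕ) : ℝ) ^ 4 = 2 ^ 24 * (Q : ℝ) ^ 8 := by push_cast; ring
  have ht43 : t ^ 43 = 2 ^ ε * (Q : ℝ) ^ ε := by
    have he : ((43 : ℕ) : ℝ) * δ = ε := by rw [hδdef]; push_cast; ring
    rw [ht, ← rpow_pow_comm hBr0 43 δ, ← Real.rpow_natCast (B : ℝ) 43, ← Real.rpow_mul hBr0, he, hBdef]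
    push_cast
    exact Real.mul_rpow (by norm_num) hQ0.le
  have hQpow : (Q : ℝ) ^ (2 + ε) = (Q : ℝ) ^ 2 * (Q : ℝ) ^ ε := by
    rw [Real.rpow_add hQ0, Real.rpow_two]
  calc ∑ q ∈ (Finset.Icc Q (2 * Q)).filter Squarefree, dualDensity (psiMod q)
      ≤ ((16 * (2 * Q) ^ 2 : ℕ) : ℝ) ^ 4 * (K₁ * t ^ 43 / (Q : ℝ) ^ 6 + K₂ * t ^ 43 / (Q : ℝ) ^ 6) :=
        hmaster.trans (mul_le_mul_of_nonneg_left (add_le_add hsum hlarge) (by positivity))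
    _ = 2 ^ 24 * (K₁ + K₂) * 2 ^ ε * ((Q : ℝ) ^ 2 * (Q : ℝ) ^ ε) := by
        rw [hM, ht43]; field_simp
    _ = 2 ^ 24 * (K₁ + K₂) * 2 ^ ε * (Q : ℝ) ^ (2 + ε) := by rw [hQpow]


end FinalFour

end Literature.NumberTheory.CubicFields

end
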